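import Literature.NumberTheory.EllipticCurves.BertrandCMHeightNonvanishingOddPrime
import Literature.NumberTheory.EllipticCurves.Rank1Residual.Predicates
import Literature.NumberTheory.EllipticCurves.LeadingTerm
import HarnessLib

/-!
# X10b, Schneider aside (item 20683), CM half: the registered stub `stub_schneiderCM` of the
# `cm-first` line closes BY NAME from Bertrand 1984 at an odd prime + Gross–Zagier–Kolyvagin
# (print cell `bsd-print-x9`, seat p3; PLAN v2.3 §7(c); per-pair / display use only — `SchneiderX10bRankOne`
# is an ASIDE of route PrintX10b, never route currency)

The birth skeleton `Cruxes/SchneiderX10bRankOne/Lines/cm-first` (HOME/plan/Lines-birth-SchneiderX10bRankOne.lean)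
splits Schneider's conjecture on the rank-1 members of X10b by complex multiplication.  Its first
stub, VERBATIM,

  `∀ W p, ClassX10 W p → ¬ Surj W 3 → W.analyticRank = 1 → W.HasCM →
     ∀ Dh : PAdicHeightData W p, Dh.IsCanonical → SchneiderConjecture Dh`,

is the conclusion of two PUBLISHED inputs, both tree named facts taken BY NAME as hypotheses (so the
theorem below is CONDITIONAL on exactly them, nothing else):
* `bertrand_pairing_self_ne_zero_of_hasCM_odd` — Bertrand 1984 §3 Cor. 1 / 1982 §3 Cor. 4: on a CM
  curve the canonical cyclotomic `p`-adic height of a non-torsion rational point is non-zero at an odd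
  good ordinary `p` (typed by the literature seat; its rank-one regulator form is the PROVED corollary
  `schneiderConjecture_of_hasCM_of_rank_one_odd`);
* `rank_eq_analyticRank_of_analyticRank_le_one` — Gross–Zagier–Kolyvagin (bsd.S17): `r_an ≤ 1 ⇒
  rank E(ℚ) = r_an` (turns the stub's `W.analyticRank = 1` into `W.mordellWeilRank = 1`).
`ClassX10 W p` supplies `p = 3` and good ORDINARY reduction at `3` directly (no Deuring step), so the
proof is bookkeeping.  Same mechanism as the K-lane's `RowC17.schneiderCertificate_three_of_bertrand_odd`
(`Partition/MainConjecturesCMThreeBertrand.lean`, row C17 = CM ∧ r_an = 1 ∧ 3 split), here on the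
X10b binder shape (`ClassX10`, `¬ Surj W 3`, `HasCM`) of the registered stub.

A second form `X10b.schneiderCM_of_bertrand_odd_of_rank_one` takes `W.mordellWeilRank = 1` instead of
GZK (one named fact fewer; for records that certify the algebraic rank).

Not a class theorem and not progress on the non-CM stub (open; per pair it is READ OFF one
coefficient of `L_3`, `coeff_one_padicLFunction_ne_zero_iff_schneider_odd`, seat p3 g0).
beyond-print theorem: no (two printed inputs by name).

References: [Bertrand1984ThetaCM] §3 Cor. 1 (p. 21); [Bertrand1982] §3 Cor. 4 (p. 8);
[GrossZagier1986], [Kolyvagin1990] (bsd.S17); [Schneider1985] (the conjecture); cell files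
HOME/plan/Lines-birth-SchneiderX10bRankOne.lean, PLAN.md v2.3 §7(c).
-/

set_option autoImplicit false

noncomputable section

open WeierstrassCurve Literature.NumberTheory.EllipticCurves
  Literature.NumberTheory.EllipticCurves.Rank1Residual

namespace Summit.BirchSwinnertonDyer.Rank1Residual

/-- **`stub_schneiderCM` with the algebraic rank as input (Bertrand only).** For `W/ℚ` in class X10
(so `p = 3`, good ordinary at `3`) with CM and `rank E(ℚ) = 1`, every canonical cyclotomic `3`-adic
height datum satisfies Schneider's conjecture — Bertrand's theorem at the odd prime `3` in its
rank-one regulator form `schneiderConjecture_of_hasCM_of_rank_one_odd`. (`¬ Surj W 3` and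
`W.analyticRank = 1` are carried only to match the stub's binder shape.)
[cite: Bertrand1984ThetaCM, §3 Corollaire 1 (p. 21)] [cite: Bertrand1982, §3 Corollaire 4 (p. 8)] -/
theorem X10b.schneiderCM_of_bertrand_odd_of_rank_one
    (hBerO : bertrand_pairing_self_ne_zero_of_hasCM_odd)
    (W : WeierstrassCurve ℚ) [W.IsElliptic] [W.IsGloballyMinimal] (p : ℕ) [Fact p.Prime]
    (hX : ClassX10 W p) (_hns : ¬ Surj W 3) (hrank : W.mordellWeilRank = 1) (hCM : W.HasCM)
    (Dh : WeierstrassCurve.PAdicHeightData W p) (hDh : Dh.IsCanonical) :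
    WeierstrassCurve.SchneiderConjecture Dh := by
  obtain ⟨rfl, hord, -, -⟩ := hX
  exact schneiderConjecture_of_hasCM_of_rank_one_odd hBerO W hCM 3 (by decide) hord.1 hord.2 hrank
    Dh hDh

/-- **The registered stub `stub_schneiderCM` (line `cm-first` of crux `SchneiderX10bRankOne`,
item 20683), BY NAME from Bertrand (odd prime) + Gross–Zagier–Kolyvagin.** Conclusion = the stub's
signature verbatim; hypotheses = the two named facts. [cite: Bertrand1984ThetaCM, §3 Corollaire 1 (p. 21)]
[cite: GrossZagier1986] [cite: Kolyvagin1990] -/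
theorem X10b.stub_schneiderCM_of_bertrand_odd_of_gzk
    (hBerO : bertrand_pairing_self_ne_zero_of_hasCM_odd)
    (hGZK : rank_eq_analyticRank_of_analyticRank_le_one) :
    ∀ (W : WeierstrassCurve ℚ) [W.IsElliptic] [W.IsGloballyMinimal] (p : ℕ) [Fact p.Prime],
      ClassX10 W p → ¬ Surj W 3 → W.analyticRank = 1 → W.HasCM →
        ∀ Dh : WeierstrassCurve.PAdicHeightData W p, Dh.IsCanonical →
          WeierstrassCurve.SchneiderConjecture Dh := by
  intro W _ _ p _ hX hns hr hCM Dh hDh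
  have hrank : W.mordellWeilRank = 1 := ((hGZK W hr.le).1).trans hr
  exact X10b.schneiderCM_of_bertrand_odd_of_rank_one hBerO W p hX hns hrank hCM Dh hDh

end Summit.BirchSwinnertonDyer.Rank1Residual

end
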